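import Summits.RiemannHypothesis.RiemannHypothesis.Theorems.LiTailLaguerreFejerModel
import HarnessLib

/-!
# RiemannHypothesis / LiTailLaguerre — Fejér companion, part 6: the residual of the discrete WKB model and the
# Casoratian window (RH-FREE)

RH-FREE [rh-li-eng g6].  Cell `pub/rh-li`; sequel to `Theorems/LiTailLaguerreFejerModel.lean` (see its docstring for
the discrete Liouville–Green bootstrap this serves).  With `h = 1/n`, `ω = √(y/n)`, `δ± = ω(1 + d±)` the phase
increments of `φ_n = 2√(ny) + π/4` (`|d₊ + h/4| ≤ h²/8`, `|d₋ − h/4| ≤ h²/4`) and `(1 ± h)^{1/4} = 1 ± h/4 + O(h²)`: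

* `norm_bracket_le` — the polynomial part `(1 + h/4)(1 + iδ₊ − δ₊²/2 − iδ₊³/6) + (1 − h/4)(1 − iδ₋ − δ₋²/2 + iδ₋³/6)
  − 2 + ω²` has norm `≤ (1 + y + y²)h²`: the orders `1, ω h, ω², ω³` all CANCEL (the discrete WKB conditions: amplitude
  `n^{1/4}`, phase `2√(ny)`), leaving `ω·O(h²) + ω²·O(h²) + ω³·O(h)`;
* `norm_res_le` — **`‖z_{n+1} + z_{n−1} − (2 − y/n) z_n‖ ≤ 2(1 + y + y²) n^{1/4}/n²`** for `n ≥ max(2, 4y)`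
  (bracket + the `O(h²)` amplitude remainders + the cubic Taylor remainders `(5/96)δ⁴ ≤ 0.32 y²h²`);
* `im_conj_zm_mul`, `im_conj_zm_mul_bounds` — `Im(z̄_n z_{n+1}) = n^{1/4}(n+1)^{1/4} sin(φ_{n+1} − φ_n) ∈ [√y/2, 2√y]`.

Nothing here bears on the truth of RH.
-/

noncomputable section

-- D-0017: `Summit.<S>.<S>.…` is the designed namespace of a single-problem summit.
set_option linter.dupNamespace false

open Complex

namespace Summit.RiemannHypothesis.RiemannHypothesis.Theorems.LiTheory

namespace Fejer

/-! ### The residual of the model -/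

set_option maxHeartbeats 800000 in -- long real-inequality bookkeeping; no search
/-- The polynomial bracket: for reals `h, ω, d₊, d₋` with `0 ≤ h ≤ 1/2`, `0 ≤ ω ≤ 1/2`, `ω² = yh`,
`|d₊ + h/4| ≤ h²/8`, `|d₋ − h/4| ≤ h²/4`:
`‖(1 + h/4)(1 + iδ₊ − δ₊²/2 − iδ₊³/6) + (1 − h/4)(1 − iδ₋ − δ₋²/2 + iδ₋³/6) − 2 + ω²‖ ≤ (1 + y + y²) h²`,
`δ± = ω(1 + d±)` (every term of order `< h²` cancels: the discrete WKB conditions). -/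
theorem norm_bracket_le {y h ω dp dm : ℝ} (hy : 0 ≤ y) (h0 : 0 ≤ h) (h1 : h ≤ 1 / 2) (hω0 : 0 ≤ ω)
    (hω1 : ω ≤ 1 / 2) (hω : ω ^ 2 = y * h) (hdp : |dp + h / 4| ≤ h ^ 2 / 8) (hdm : |dm - h / 4| ≤ h ^ 2 / 4) :
    ‖(1 + (h : ℂ) / 4) * (1 + I * ↑(ω * (1 + dp)) - (↑(ω * (1 + dp)) : ℂ) ^ 2 / 2 - I * (↑(ω * (1 + dp)) : ℂ) ^ 3 / 6)
        + (1 - (h : ℂ) / 4) * (1 - I * ↑(ω * (1 + dm)) - (↑(ω * (1 + dm)) : ℂ) ^ 2 / 2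
            + I * (↑(ω * (1 + dm)) : ℂ) ^ 3 / 6)
        - 2 + (ω : ℂ) ^ 2‖ ≤ (1 + y + y ^ 2) * h ^ 2 := by
  -- the three real brackets
  set B1 : ℝ := (1 + h / 4) * (1 + dp) - (1 - h / 4) * (1 + dm) with hB1
  set B2 : ℝ := (1 + h / 4) * (1 + dp) ^ 2 + (1 - h / 4) * (1 + dm) ^ 2 - 2 with hB2
  set B3 : ℝ := (1 + h / 4) * (1 + dp) ^ 3 - (1 - h / 4) * (1 + dm) ^ 3 with hB3
  have e : (1 + (h : ℂ) / 4) * (1 + I * ↑(ω * (1 + dp)) - (↑(ω * (1 + dp)) : ℂ) ^ 2 / 2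
          - I * (↑(ω * (1 + dp)) : ℂ) ^ 3 / 6)
        + (1 - (h : ℂ) / 4) * (1 - I * ↑(ω * (1 + dm)) - (↑(ω * (1 + dm)) : ℂ) ^ 2 / 2
          + I * (↑(ω * (1 + dm)) : ℂ) ^ 3 / 6)
        - 2 + (ω : ℂ) ^ 2
      = ((-(ω ^ 2 / 2 * B2) : ℝ) : ℂ) + ((ω * B1 - ω ^ 3 / 6 * B3 : ℝ) : ℂ) * I := by
    rw [hB1, hB2, hB3]
    push_cast
    ring_nf
  rw [e]
  -- bounds on d±
  obtain ⟨hdp1, hdp2⟩ := abs_le.1 hdp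
  obtain ⟨hdm1, hdm2⟩ := abs_le.1 hdm
  set rp := dp + h / 4 with hrp
  set rm := dm - h / 4 with hrm
  have hdp' : dp = -h / 4 + rp := by rw [hrp]; ring
  have hdm' : dm = h / 4 + rm := by rw [hrm]; ring
  have hh2 : h ^ 2 ≤ h / 2 := by nlinarith
  have hB1b : |B1| ≤ 1 / 2 * h ^ 2 := by
    have : B1 = rp - rm + h / 4 * (rp + rm) := by rw [hB1, hdp', hdm']; ring
    rw [this, abs_le]; constructor <;> nlinarith
  have hdpb : |dp| ≤ 3 / 8 * h := by rw [hdp', abs_le]; constructor <;> nlinarith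
  have hdmb : |dm| ≤ 3 / 8 * h := by rw [hdm', abs_le]; constructor <;> nlinarith
  obtain ⟨hdpl, hdpu⟩ := abs_le.1 hdpb
  obtain ⟨hdml, hdmu⟩ := abs_le.1 hdmb
  have hB2b : |B2| ≤ 3 / 2 * h ^ 2 := by
    have : B2 = 2 * (rp + rm) + (dp ^ 2 + dm ^ 2) + h / 2 * (-h / 2 + rp - rm) + h / 4 * (dp ^ 2 - dm ^ 2) := by
      rw [hB2, hdp', hdm']; ring
    have hd1 : dp ^ 2 ≤ (3 / 8 * h) ^ 2 := sq_le_sq' hdpl hdpu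
    have hd2 : dm ^ 2 ≤ (3 / 8 * h) ^ 2 := sq_le_sq' hdml hdmu
    have p1 : h * rp ≤ h * (h ^ 2 / 8) := mul_le_mul_of_nonneg_left hdp2 h0
    have p2 : h * (-(h ^ 2 / 8)) ≤ h * rp := mul_le_mul_of_nonneg_left hdp1 h0
    have p3 : h * rm ≤ h * (h ^ 2 / 4) := mul_le_mul_of_nonneg_left hdm2 h0
    have p4 : h * (-(h ^ 2 / 4)) ≤ h * rm := mul_le_mul_of_nonneg_left hdm1 h0
    have p5 : h * dp ^ 2 ≤ h * (3 / 8 * h) ^ 2 := mul_le_mul_of_nonneg_left hd1 h0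
    have p6 : h * dm ^ 2 ≤ h * (3 / 8 * h) ^ 2 := mul_le_mul_of_nonneg_left hd2 h0
    have p7 : h ^ 3 ≤ 1 / 2 * h ^ 2 := by
      rw [pow_succ]; exact (mul_le_mul_of_nonneg_left h1 (sq_nonneg h)).trans_eq (by ring)
    have p8 : 0 ≤ h * dp ^ 2 := mul_nonneg h0 (sq_nonneg dp)
    have p9 : 0 ≤ h * dm ^ 2 := mul_nonneg h0 (sq_nonneg dm)
    have p10 : 0 ≤ h ^ 3 := pow_nonneg h0 3
    rw [this, abs_le]
    constructor <;> linarith [sq_nonneg dp, sq_nonneg dm, sq_nonneg h]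
  have hB3b : |B3| ≤ 6 * h := by
    have hsplit : B3 = (dp - dm) * ((1 + dp) ^ 2 + (1 + dp) * (1 + dm) + (1 + dm) ^ 2)
        + h / 4 * ((1 + dp) ^ 3 + (1 + dm) ^ 3) := by
      rw [hB3]; ring
    have hp1 : 0 ≤ 1 + dp := by linarith
    have hm1 : 0 ≤ 1 + dm := by linarith
    have hp2 : 1 + dp ≤ 19 / 16 := by linarith
    have hm2 : 1 + dm ≤ 19 / 16 := by linarith
    have hQ0 : 0 ≤ (1 + dp) ^ 2 + (1 + dp) * (1 + dm) + (1 + dm) ^ 2 := by positivity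
    have hQ : (1 + dp) ^ 2 + (1 + dp) * (1 + dm) + (1 + dm) ^ 2 ≤ 9 / 2 := by nlinarith
    have hC0 : 0 ≤ (1 + dp) ^ 3 + (1 + dm) ^ 3 := by positivity
    have hC : (1 + dp) ^ 3 + (1 + dm) ^ 3 ≤ 7 / 2 := by
      nlinarith [pow_le_pow_left₀ hp1 hp2 3, pow_le_pow_left₀ hm1 hm2 3]
    have hdd : |dp - dm| ≤ 3 / 4 * h := by rw [abs_le]; constructor <;> linarith
    rw [hsplit]
    refine (abs_add_le _ _).trans ?_
    rw [abs_mul, abs_of_nonneg hQ0, abs_mul, abs_of_nonneg (by positivity : (0 : ℝ) ≤ h / 4), abs_of_nonneg hC0]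
    have m1 : |dp - dm| * ((1 + dp) ^ 2 + (1 + dp) * (1 + dm) + (1 + dm) ^ 2) ≤ 3 / 4 * h * (9 / 2) :=
      mul_le_mul hdd hQ hQ0 (by positivity)
    have m2 : h / 4 * ((1 + dp) ^ 3 + (1 + dm) ^ 3) ≤ h / 4 * (7 / 2) := mul_le_mul_of_nonneg_left hC (by positivity)
    linarith
  -- combine
  refine (Complex.norm_le_abs_re_add_abs_im _).trans ?_
  have hre' : (((-(ω ^ 2 / 2 * B2) : ℝ) : ℂ) + ((ω * B1 - ω ^ 3 / 6 * B3 : ℝ) : ℂ) * I).re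
      = -(ω ^ 2 / 2 * B2) := by
    rw [Complex.add_re, Complex.ofReal_re, Complex.mul_re, Complex.ofReal_re, Complex.ofReal_im, Complex.I_re,
      Complex.I_im]; ring
  have him' : (((-(ω ^ 2 / 2 * B2) : ℝ) : ℂ) + ((ω * B1 - ω ^ 3 / 6 * B3 : ℝ) : ℂ) * I).im
      = ω * B1 - ω ^ 3 / 6 * B3 := by
    rw [Complex.add_im, Complex.ofReal_im, Complex.mul_im, Complex.ofReal_re, Complex.ofReal_im, Complex.I_re,
      Complex.I_im]; ring
  rw [hre', him']
  have hω3 : ω ^ 3 = y * h * ω := by rw [pow_succ, hω]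
  have hre : |(-(ω ^ 2 / 2 * B2))| ≤ 3 / 4 * y * h ^ 3 := by
    rw [abs_neg, abs_mul, abs_of_nonneg (by positivity : (0 : ℝ) ≤ ω ^ 2 / 2), hω]
    calc y * h / 2 * |B2| ≤ y * h / 2 * (3 / 2 * h ^ 2) := mul_le_mul_of_nonneg_left hB2b (by positivity)
      _ = 3 / 4 * y * h ^ 3 := by ring
  have him : |ω * B1 - ω ^ 3 / 6 * B3| ≤ 1 / 4 * h ^ 2 + y * h * ω * h := by
    refine (abs_sub _ _).trans ?_
    rw [abs_mul, abs_of_nonneg hω0, abs_mul, abs_of_nonneg (by positivity : (0 : ℝ) ≤ ω ^ 3 / 6), hω3]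
    have t1 : ω * |B1| ≤ 1 / 2 * (1 / 2 * h ^ 2) := mul_le_mul hω1 hB1b (abs_nonneg _) (by norm_num)
    have t2 : y * h * ω / 6 * |B3| ≤ y * h * ω / 6 * (6 * h) := mul_le_mul_of_nonneg_left hB3b (by positivity)
    linarith
  have hf1 : y * h * ω * h ≤ 1 / 2 * y * h ^ 2 := by
    have e2 : y * h * ω * h = (y * h ^ 2) * ω := by ring
    have : (y * h ^ 2) * ω ≤ (y * h ^ 2) * (1 / 2) := mul_le_mul_of_nonneg_left hω1 (by positivity)
    linarith
  have hf2 : y * h ^ 3 ≤ 1 / 2 * y * h ^ 2 := by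
    have e2 : y * h ^ 3 = (y * h ^ 2) * h := by ring
    have : (y * h ^ 2) * h ≤ (y * h ^ 2) * (1 / 2) := mul_le_mul_of_nonneg_left h1 (by positivity)
    linarith
  have hnn1 : 0 ≤ y * h ^ 2 := by positivity
  have hnn2 : 0 ≤ y ^ 2 * h ^ 2 := by positivity
  have hnn3 : 0 ≤ h ^ 2 := sq_nonneg h
  linarith

set_option maxHeartbeats 800000 in -- long bookkeeping with many abbreviations; no search
/-- **The model residual.**  For `0 < y`, `2 ≤ n`, `4y ≤ n`:
`‖z_{n+1} + z_{n−1} − (2 − y/n) z_n‖ ≤ 2(1 + y + y²) n^{1/4}/n²`. -/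
theorem norm_res_le {y : ℝ} (hy : 0 < y) {n : ℕ} (hn : 2 ≤ n) (hny : 4 * y ≤ n) :
    ‖zm y (n + 1) + zm y (n - 1) - (2 - (y : ℂ) / n) * zm y n‖ ≤ 2 * (1 + y + y ^ 2) * qrt n / (n : ℝ) ^ 2 := by
  have hn0 : (0 : ℝ) < n := by exact_mod_cast (show 0 < n by omega)
  have hn2 : (2 : ℝ) ≤ n := by exact_mod_cast hn
  set h : ℝ := 1 / n with hh
  have h0 : 0 < h := by positivity
  have h1 : h ≤ 1 / 2 := by rw [hh, div_le_div_iff₀ hn0 (by norm_num)]; linarith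
  set ω : ℝ := Real.sqrt (y / n) with hω
  have hωsq : ω ^ 2 = y * h := by rw [hω, Real.sq_sqrt (by positivity), hh]; ring
  have hω0 : 0 ≤ ω := Real.sqrt_nonneg _
  have hω1 : ω ≤ 1 / 2 := by
    rw [hω, show (1 / 2 : ℝ) = Real.sqrt ((1 / 2) ^ 2) by rw [Real.sqrt_sq (by norm_num)]]
    apply Real.sqrt_le_sqrt
    rw [div_le_iff₀ hn0]; linarith
  -- steps
  obtain ⟨hzp, hzm⟩ := zm_steps y hn
  set dp : ℝ := 2 * (Real.sqrt (1 + 1 / n) - 1) / (1 / n) - 1 with hdp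
  set dm : ℝ := 2 * (1 - Real.sqrt (1 - 1 / n)) / (1 / n) - 1 with hdm
  have hδp : phi y (n + 1) - phi y n = ω * (1 + dp) := phi_succ_sub hy.le (by omega)
  have hδm : phi y n - phi y (n - 1) = ω * (1 + dm) := phi_sub_pred hy.le hn
  -- Taylor data
  obtain ⟨hs1, hs2⟩ := sqrt_one_add_bounds h0.le (by linarith)
  obtain ⟨ht1, ht2⟩ := sqrt_one_sub_bounds h0.le h1
  have hdpb : |dp + h / 4| ≤ h ^ 2 / 8 := by
    have e : dp + h / 4 = 2 * (Real.sqrt (1 + h) - 1 - h / 2 + h ^ 2 / 8) / h := by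
      rw [hdp, hh]; field_simp; ring
    rw [e, abs_div, abs_of_pos h0, div_le_iff₀ h0, abs_le]
    constructor <;> nlinarith
  have hdmb : |dm - h / 4| ≤ h ^ 2 / 4 := by
    have e : dm - h / 4 = 2 * (-(Real.sqrt (1 - h) - 1 + h / 2 + h ^ 2 / 8)) / h := by
      rw [hdm, hh]; field_simp; ring
    rw [e, abs_div, abs_of_pos h0, div_le_iff₀ h0, abs_le]
    constructor <;> nlinarith
  obtain ⟨hq1, hq2⟩ := qrt_one_add_bounds h0.le h1
  obtain ⟨hr1, hr2⟩ := qrt_one_sub_bounds h0.le h1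
  set ap := qrt (1 + h) with hap
  set am := qrt (1 - h) with ham
  set αp := ap - 1 - h / 4 with hαp
  set αm := am - 1 + h / 4 with hαm
  have hαpb : |αp| ≤ h ^ 2 / 8 := by rw [hαp, abs_le]; constructor <;> linarith
  have hαmb : |αm| ≤ h ^ 2 / 4 := by rw [hαm, abs_le]; constructor <;> linarith
  -- the phases are ≤ 1 in absolute value
  set δp := ω * (1 + dp) with hδpdef
  set δm := ω * (1 + dm) with hδmdef
  have hhh : h ^ 2 ≤ 1 / 2 * h := by rw [sq]; exact mul_le_mul_of_nonneg_right h1 h0.le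
  have hdp_small : |dp| ≤ 3 / 8 * h := by
    obtain ⟨a, b⟩ := abs_le.1 hdpb; rw [abs_le]; constructor <;> linarith
  have hdm_small : |dm| ≤ 3 / 8 * h := by
    obtain ⟨a, b⟩ := abs_le.1 hdmb; rw [abs_le]; constructor <;> linarith
  obtain ⟨hdpl, hdpu⟩ := abs_le.1 hdp_small
  obtain ⟨hdml, hdmu⟩ := abs_le.1 hdm_small
  have h1p0 : 0 ≤ 1 + dp := by linarith
  have h1m0 : 0 ≤ 1 + dm := by linarith
  have h1p1 : 1 + dp ≤ 3 / 2 := by linarith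
  have h1m1 : 1 + dm ≤ 3 / 2 := by linarith
  have hδp0 : 0 ≤ δp := mul_nonneg hω0 h1p0
  have hδm0 : 0 ≤ δm := mul_nonneg hω0 h1m0
  have hhalf : (0 : ℝ) ≤ 1 / 2 := by norm_num
  have hδpu : δp ≤ 1 / 2 * (3 / 2) := mul_le_mul hω1 h1p1 h1p0 hhalf
  have hδmu : δm ≤ 1 / 2 * (3 / 2) := mul_le_mul hω1 h1m1 h1m0 hhalf
  have hδp1 : |δp| ≤ 1 := by rw [abs_of_nonneg hδp0]; linarith
  have hδm1 : |δm| ≤ 1 := by rw [abs_of_nonneg hδm0]; linarith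
  have hω4n : 0 ≤ ω ^ 4 := pow_nonneg hω0 4
  have hδp4 : δp ^ 4 ≤ 6 * ω ^ 4 := by
    have h14 : (1 + dp) ^ 4 ≤ (3 / 2 : ℝ) ^ 4 := pow_le_pow_left₀ h1p0 h1p1 4
    rw [hδpdef, mul_pow]
    have := mul_le_mul_of_nonneg_left h14 hω4n
    linarith
  have hδm4 : δm ^ 4 ≤ 6 * ω ^ 4 := by
    have h14 : (1 + dm) ^ 4 ≤ (3 / 2 : ℝ) ^ 4 := pow_le_pow_left₀ h1m0 h1m1 4
    rw [hδmdef, mul_pow]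
    have := mul_le_mul_of_nonneg_left h14 hω4n
    linarith
  -- Taylor remainders of the exponentials
  set γp := cexp (I * δp) - (1 + I * δp - (δp : ℂ) ^ 2 / 2 - I * (δp : ℂ) ^ 3 / 6) with hγp
  set γm := cexp (I * ↑(-δm)) - (1 + I * ↑(-δm) - ((-δm : ℝ) : ℂ) ^ 2 / 2 - I * ((-δm : ℝ) : ℂ) ^ 3 / 6) with hγm
  have hγpb : ‖γp‖ ≤ 5 / 96 * δp ^ 4 := norm_cexp_sub_taylor_le hδp1
  have hγmb : ‖γm‖ ≤ 5 / 96 * δm ^ 4 := by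
    have := norm_cexp_sub_taylor_le (δ := -δm) (by rwa [abs_neg])
    rwa [neg_pow, show ((-1 : ℝ)) ^ 4 = 1 by norm_num, one_mul] at this
  -- the residual as `z_n · T`
  have hres : zm y (n + 1) + zm y (n - 1) - (2 - (y : ℂ) / n) * zm y n
      = zm y n * ((ap : ℂ) * cexp (I * δp) + (am : ℂ) * cexp (I * ↑(-δm)) - 2 + (ω : ℂ) ^ 2) := by
    rw [hzp, hzm, hδp, hδm]
    have hω2 : ((ω : ℂ)) ^ 2 = (y : ℂ) / n := by
      rw [← Complex.ofReal_pow, hωsq, hh]; push_cast; ring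
    rw [hω2, hap, ham, hh, hδpdef, hδmdef]
    push_cast
    ring_nf
  rw [hres, norm_mul, norm_zm]
  -- bound `‖T‖`
  have hT : ‖(ap : ℂ) * cexp (I * δp) + (am : ℂ) * cexp (I * ↑(-δm)) - 2 + (ω : ℂ) ^ 2‖
      ≤ 2 * (1 + y + y ^ 2) * h ^ 2 := by
    have eT : (ap : ℂ) * cexp (I * δp) + (am : ℂ) * cexp (I * ↑(-δm)) - 2 + (ω : ℂ) ^ 2
        = ((1 + (h : ℂ) / 4) * (1 + I * ↑(ω * (1 + dp)) - (↑(ω * (1 + dp)) : ℂ) ^ 2 / 2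
              - I * (↑(ω * (1 + dp)) : ℂ) ^ 3 / 6)
            + (1 - (h : ℂ) / 4) * (1 - I * ↑(ω * (1 + dm)) - (↑(ω * (1 + dm)) : ℂ) ^ 2 / 2
              + I * (↑(ω * (1 + dm)) : ℂ) ^ 3 / 6)
            - 2 + (ω : ℂ) ^ 2)
          + ((αp : ℂ) * cexp (I * δp) + (αm : ℂ) * cexp (I * ↑(-δm))
            + (1 + (h : ℂ) / 4) * γp + (1 - (h : ℂ) / 4) * γm) := by
      rw [hγp, hγm, hαp, hαm, hδpdef, hδmdef]
      push_cast
      ring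
    rw [eT]
    refine (norm_add_le _ _).trans ?_
    have hP := norm_bracket_le hy.le h0.le h1 hω0 hω1 hωsq hdpb hdmb
    have n1 : ‖(αp : ℂ) * cexp (I * δp)‖ ≤ h ^ 2 / 8 := by
      rw [norm_mul, Complex.norm_real, Literature.Analysis.Fourier.norm_exp_I_mul_ofReal, mul_one,
        Real.norm_eq_abs]; exact hαpb
    have n2 : ‖(αm : ℂ) * cexp (I * ↑(-δm))‖ ≤ h ^ 2 / 4 := by
      rw [norm_mul, Complex.norm_real, Literature.Analysis.Fourier.norm_exp_I_mul_ofReal, mul_one,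
        Real.norm_eq_abs]; exact hαmb
    have hc1 : ‖(1 + (h : ℂ) / 4)‖ ≤ 9 / 8 := by
      rw [show (1 + (h : ℂ) / 4) = ((1 + h / 4 : ℝ) : ℂ) by push_cast; ring, Complex.norm_real,
        Real.norm_eq_abs, abs_of_pos (by positivity)]; linarith
    have hc2 : ‖(1 - (h : ℂ) / 4)‖ ≤ 1 := by
      rw [show (1 - (h : ℂ) / 4) = ((1 - h / 4 : ℝ) : ℂ) by push_cast; ring, Complex.norm_real,
        Real.norm_eq_abs, abs_of_pos (by linarith)]; linarith
    have n3 : ‖(1 + (h : ℂ) / 4) * γp‖ ≤ 9 / 8 * (5 / 96 * (6 * ω ^ 4)) := by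
      rw [norm_mul]
      exact mul_le_mul hc1 (hγpb.trans (by linarith)) (norm_nonneg _) (by norm_num)
    have n4 : ‖(1 - (h : ℂ) / 4) * γm‖ ≤ 1 * (5 / 96 * (6 * ω ^ 4)) := by
      rw [norm_mul]
      exact mul_le_mul hc2 (hγmb.trans (by linarith)) (norm_nonneg _) (by norm_num)
    have hrest : ‖(αp : ℂ) * cexp (I * δp) + (αm : ℂ) * cexp (I * ↑(-δm))
        + (1 + (h : ℂ) / 4) * γp + (1 - (h : ℂ) / 4) * γm‖ ≤ h ^ 2 / 8 + h ^ 2 / 4 + ω ^ 4 := by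
      have s1 := norm_add_le ((αp : ℂ) * cexp (I * δp)) ((αm : ℂ) * cexp (I * ↑(-δm)))
      have s2 := norm_add_le ((αp : ℂ) * cexp (I * δp) + (αm : ℂ) * cexp (I * ↑(-δm))) ((1 + (h : ℂ) / 4) * γp)
      have s3 := norm_add_le ((αp : ℂ) * cexp (I * δp) + (αm : ℂ) * cexp (I * ↑(-δm)) + (1 + (h : ℂ) / 4) * γp)
        ((1 - (h : ℂ) / 4) * γm)
      linarith
    have hω4 : ω ^ 4 = y ^ 2 * h ^ 2 := by
      rw [show (4 : ℕ) = 2 * 2 from rfl, pow_mul, hωsq]; ring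
    rw [hω4] at hrest
    have := add_le_add hP hrest
    refine this.trans ?_
    have hnn1 : 0 ≤ y * h ^ 2 := by positivity
    have hnn2 : 0 ≤ y ^ 2 * h ^ 2 := by positivity
    have hnn3 : 0 ≤ h ^ 2 := sq_nonneg h
    linarith
  calc qrt n * ‖(ap : ℂ) * cexp (I * δp) + (am : ℂ) * cexp (I * ↑(-δm)) - 2 + (ω : ℂ) ^ 2‖
      ≤ qrt n * (2 * (1 + y + y ^ 2) * h ^ 2) := mul_le_mul_of_nonneg_left hT (qrt_nonneg _)
    _ = 2 * (1 + y + y ^ 2) * qrt n / (n : ℝ) ^ 2 := by rw [hh]; field_simp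

/-! ### The Casoratian window -/

/-- `Im(z̄_n z_{n+1}) = n^{1/4}(n+1)^{1/4} sin(φ_{n+1} − φ_n)`. -/
theorem im_conj_zm_mul (y : ℝ) (n : ℕ) :
    ((starRingEnd ℂ) (zm y n) * zm y (n + 1)).im
      = qrt n * qrt ((n + 1 : ℕ) : ℝ) * Real.sin (phi y (n + 1) - phi y n) := by
  unfold zm
  rw [map_mul, Complex.conj_ofReal, ← Complex.exp_conj, map_mul, Complex.conj_I, Complex.conj_ofReal]
  have e : ((qrt n : ℝ) : ℂ) * cexp (-I * (phi y n : ℂ))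
        * (((qrt ((n + 1 : ℕ) : ℝ) : ℝ) : ℂ) * cexp (I * (phi y (n + 1) : ℂ)))
      = ((qrt n * qrt ((n + 1 : ℕ) : ℝ) : ℝ) : ℂ) * cexp (((phi y (n + 1) - phi y n : ℝ) : ℂ) * I) := by
    rw [mul_mul_mul_comm, ← Complex.exp_add]
    push_cast
    ring_nf
  rw [e, Complex.im_ofReal_mul, Complex.exp_ofReal_mul_I_im]

/-- **The Casoratian window.**  For `0 < y`, `2 ≤ n`, `4y ≤ n`: `√y/2 ≤ Im(z̄_n z_{n+1}) ≤ 2√y`. -/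
theorem im_conj_zm_mul_bounds {y : ℝ} (hy : 0 < y) {n : ℕ} (hn : 2 ≤ n) (hny : 4 * y ≤ n) :
    Real.sqrt y / 2 ≤ ((starRingEnd ℂ) (zm y n) * zm y (n + 1)).im ∧
      ((starRingEnd ℂ) (zm y n) * zm y (n + 1)).im ≤ 2 * Real.sqrt y := by
  rw [im_conj_zm_mul]
  have hn0 : (0 : ℝ) < n := by exact_mod_cast (show 0 < n by omega)
  have hn2 : (2 : ℝ) ≤ n := by exact_mod_cast hn
  set h : ℝ := 1 / n with hh
  have h0 : 0 < h := by positivity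
  have h1 : h ≤ 1 / 2 := by rw [hh, div_le_div_iff₀ hn0 (by norm_num)]; linarith
  set ω : ℝ := Real.sqrt (y / n) with hω
  have hω0 : 0 < ω := Real.sqrt_pos.2 (by positivity)
  have hω1 : ω ≤ 1 / 2 := by
    rw [hω, show (1 / 2 : ℝ) = Real.sqrt ((1 / 2) ^ 2) by rw [Real.sqrt_sq (by norm_num)]]
    apply Real.sqrt_le_sqrt
    rw [div_le_iff₀ hn0]; linarith
  -- the phase increment
  set dp : ℝ := 2 * (Real.sqrt (1 + 1 / n) - 1) / (1 / n) - 1 with hdp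
  have hδ : phi y (n + 1) - phi y n = ω * (1 + dp) := phi_succ_sub hy.le (by omega)
  obtain ⟨hs1, hs2⟩ := sqrt_one_add_bounds h0.le (by linarith)
  have hdpb : |dp + h / 4| ≤ h ^ 2 / 8 := by
    have e : dp + h / 4 = 2 * (Real.sqrt (1 + h) - 1 - h / 2 + h ^ 2 / 8) / h := by
      rw [hdp, hh]; field_simp; ring
    rw [e, abs_div, abs_of_pos h0, div_le_iff₀ h0, abs_le]
    constructor <;> nlinarith
  obtain ⟨a, b⟩ := abs_le.1 hdpb
  have hlo : 3 / 4 ≤ 1 + dp := by nlinarith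
  have hhi : 1 + dp ≤ 1 := by nlinarith
  set δ := ω * (1 + dp) with hδdef
  have hδ0 : 0 < δ := by positivity
  have hδ1 : δ ≤ 1 := by nlinarith
  have hδω : 3 / 4 * ω ≤ δ := by nlinarith
  have hδω' : δ ≤ ω := by nlinarith
  -- sin bounds
  have hsin1 : Real.sin δ ≤ δ := Real.sin_le hδ0.le
  have hsin2 : δ - δ ^ 3 / 6 ≤ Real.sin δ := (Real.sin_gt_sub_cube hδ0).le
  have hsin3 : ω / 2 ≤ Real.sin δ := by
    have hδ3 : δ ^ 3 ≤ δ := by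
      have : δ ^ 2 ≤ 1 := by nlinarith
      calc δ ^ 3 = δ ^ 2 * δ := by ring
        _ ≤ 1 * δ := mul_le_mul_of_nonneg_right this hδ0.le
        _ = δ := one_mul δ
    linarith
  have hsin0 : 0 ≤ Real.sin δ := by linarith
  -- the fourth roots
  have hq0 : 0 < qrt n := qrt_pos hn0
  have hq1 : qrt n ≤ qrt ((n + 1 : ℕ) : ℝ) := qrt_le_qrt (by push_cast; linarith)
  have hq2 : qrt ((n + 1 : ℕ) : ℝ) ≤ 2 * qrt n := by
    have : qrt ((n + 1 : ℕ) : ℝ) ≤ qrt (16 * n) := qrt_le_qrt (by push_cast; linarith)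
    refine this.trans (le_of_eq ?_)
    rw [qrt_mul (by norm_num)]
    have h16 : qrt 16 = 2 := by
      obtain ⟨l, u⟩ := qrt_bounds (a := 2) (b := 2) (x := 16) (by norm_num) (by norm_num) (by norm_num)
        (by norm_num) (by norm_num)
      linarith
    rw [h16]
  have hqq : qrt n * qrt n = Real.sqrt n := by rw [← sq, qrt_sq]
  have hωn : Real.sqrt n * ω = Real.sqrt y := by
    rw [hω, ← Real.sqrt_mul hn0.le]; congr 1; field_simp
  rw [hδ]
  constructor
  · calc Real.sqrt y / 2 = Real.sqrt n * (ω / 2) := by rw [← hωn]; ring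
      _ ≤ (qrt n * qrt n) * Real.sin δ := by rw [hqq]; gcongr
      _ ≤ qrt n * qrt ((n + 1 : ℕ) : ℝ) * Real.sin δ := by gcongr
  · calc qrt n * qrt ((n + 1 : ℕ) : ℝ) * Real.sin δ ≤ qrt n * (2 * qrt n) * ω := by
          gcongr; exact hsin1.trans hδω'
      _ = 2 * (Real.sqrt n * ω) := by rw [← hqq]; ring
      _ = 2 * Real.sqrt y := by rw [hωn]

end Fejer

end Summit.RiemannHypothesis.RiemannHypothesis.Theorems.LiTheory

end
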